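import Literature.AlgebraicGeometry.CossartJannsenSaito2020.KeyTheoremsAPI
import Literature.AlgebraicGeometry.Resolution.ExcellentBlowup
import Literature.AlgebraicGeometry.Resolution.PermissibleBlowupHilbertSamuel
import HarnessLib

/-!
# [OURS · L1 W4.2] RECOGNITION-GEOMETRY (R2), PART 0: the NEAR LOCUS of a tower is read ONE STEP AT A TIME
# (crux chain w42, line `w_ladder`; `--supports stmt-…-19249`, helper)

OURS (cell res-hironaka, slot W4.2, seat res-L1-w42-stub-2 gen 3); NOT statements of H. Hironaka's manuscript [Hironaka2017]
nor of [CossartJannsenSaito2020]. AI-drafted, weaker than expert review. Sorry-free PROOF file (no new definition), FACT-FREE.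
The P-b-free plumbing of lead-1's `RECOGNITION-CUT.md` (R2)/(R4) (CJS Def. 6.34 (ii) / 6.38 (iii): `C_q = {ξ ∈ φ_q⁻¹(x) | H(ξ) = H(x)}`):
along a tower of PERMISSIBLE blow-ups of an excellent scheme the Hilbert–Samuel function never increases (CJS Thm. 3.10 (1),
tree `IsBlowup.hsFun_le_of_isPermissible`), so a point of `X_{j+1}` is near to `x` iff it lies over a point of `X_j` near to `x`
AND is near to that point. This is what reduces the near locus `N_{j+1}` to «the near points of `π_{j+1}` over the curve
`C_j = N_j`», where P-b (res-D-pv-038) and (R3) (`…WLadderRecognitionIso`, p516852) take over.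

* `Helpers.BlowupTowerNear.isExcellent` / `hsFun_le_step` / `hsFun_le_of_over` — excellence and `H` monotonicity along the tower.
* `Helpers.BlowupTowerNear.mem_nearLocus_succ_iff` — **`ξ ∈ N_{j+1} ↔ π ξ ∈ N_j ∧ H(ξ) = H(π ξ)`.**
* `Helpers.BlowupTowerNear.nearLocus_succ_subset` — `π(N_{j+1}) ⊆ N_j`.

## References

* V. Cossart, U. Jannsen, S. Saito, LNM 2270 (2020): Thm. 3.10 (1), Def. 6.34 (ii), Def. 6.38 (iii). [CossartJannsenSaito2020]
-/

noncomputable section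

-- namespace `…Corridor3.Helpers` re-enters `…Corridor3`
set_option linter.dupNamespace false

open CategoryTheory AlgebraicGeometry TopologicalSpace
open Literature.AlgebraicGeometry.Resolution
open Scheme.IdealSheafData

universe u

open Literature.AlgebraicGeometry.CossartJannsenSaito2020

namespace Summit.ResolutionOfSingularities.ResolutionOfSingularities.Theorems.SigmaMaxModificationsCorridor3.Helpers

namespace BlowupTowerNear

variable (T : BlowupTower.{u}) {N : ℕ}

/-- Every stage of a tower in the key setting is excellent (blow-ups of locally noetherian excellent schemes are excellent,
res-type-053's `isExcellent_of_isBlowup`). [cite: CossartJannsenSaito2020, Thm. 6.28 (setting)] -/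
theorem isExcellent (hkey : KeySetting T N) : ∀ j, Scheme.IsExcellent (T.X j) := by
  haveI : ∀ j, IsLocallyNoetherian (T.X j) := T.ln
  intro j
  induction j with
  | zero => exact hkey.excellent
  | succ j ih => exact isExcellent_of_isBlowup (T.isBlowup j) ih

/-- **`H` does not increase along one PERMISSIBLE step of the tower** (CJS Thm. 3.10 (1)). [cite: CossartJannsenSaito2020, Thm. 3.10 (1)] -/
theorem hsFun_le_step (hkey : KeySetting T N) (hperm : ∀ j, IdealSheafData.IsPermissible (T.centreIdeal j)) (j : ℕ)
    (ξ : T.X (j + 1)) : Scheme.hsFun (T.X (j + 1)) N ξ ≤ Scheme.hsFun (T.X j) N ((T.π j).base ξ) := by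
  haveI : ∀ j, IsLocallyNoetherian (T.X j) := T.ln
  exact (T.isBlowup j).hsFun_le_of_isPermissible (isExcellent T hkey j) (hperm j) N ξ

/-- **`H(ξ) ≤ H(x)` for every point `ξ ∈ X_j` over `x ∈ X_0`** along a tower of permissible blow-ups.
[cite: CossartJannsenSaito2020, Thm. 3.10 (1)] -/
theorem hsFun_le_of_over (hkey : KeySetting T N) (hperm : ∀ j, IdealSheafData.IsPermissible (T.centreIdeal j)) (x : T.X 0) :
    ∀ (j : ℕ) (ξ : T.X j), (T.phi j).base ξ = x → Scheme.hsFun (T.X j) N ξ ≤ Scheme.hsFun (T.X 0) N x := by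
  intro j
  induction j with
  | zero => intro ξ hξ; exact (congrArg _ hξ).le
  | succ j ih =>
    intro ξ hξ
    rw [BlowupTower.phi_succ_base] at hξ
    exact (hsFun_le_step T hkey hperm j ξ).trans (ih _ hξ)

/-- **THE NEAR LOCUS ONE STEP AT A TIME: `ξ ∈ N_{j+1}(x) ↔ π_{j+1}(ξ) ∈ N_j(x) ∧ H(ξ) = H(π_{j+1} ξ)`** along a tower of permissible
blow-ups in the key setting (CJS Def. 6.34 (ii) / 6.38 (iii) read inductively). [cite: CossartJannsenSaito2020, Def. 6.34 (ii), Thm. 3.10 (1)] -/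
theorem mem_nearLocus_succ_iff (hkey : KeySetting T N) (hperm : ∀ j, IdealSheafData.IsPermissible (T.centreIdeal j))
    (x : T.X 0) (j : ℕ) (ξ : T.X (j + 1)) :
    ξ ∈ T.nearLocus N x (j + 1) ↔ (T.π j).base ξ ∈ T.nearLocus N x j ∧
      Scheme.hsFun (T.X (j + 1)) N ξ = Scheme.hsFun (T.X j) N ((T.π j).base ξ) := by
  rw [BlowupTower.mem_nearLocus, BlowupTower.mem_nearLocus, BlowupTower.phi_succ_base]
  constructor
  · rintro ⟨hφ, hH⟩
    have h1 : Scheme.hsFun (T.X j) N ((T.π j).base ξ) = Scheme.hsFun (T.X 0) N x :=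
      le_antisymm (hsFun_le_of_over T hkey hperm x j _ hφ) (hH ▸ hsFun_le_step T hkey hperm j ξ)
    exact ⟨⟨hφ, h1⟩, hH.trans h1.symm⟩
  · rintro ⟨⟨hφ, hH⟩, hHξ⟩
    exact ⟨hφ, hHξ.trans hH⟩

/-- **`π_{j+1}` maps the near locus `N_{j+1}(x)` into `N_j(x)`.** [cite: CossartJannsenSaito2020, Def. 6.34 (ii), Thm. 3.10 (1)] -/
theorem nearLocus_succ_subset (hkey : KeySetting T N) (hperm : ∀ j, IdealSheafData.IsPermissible (T.centreIdeal j))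
    (x : T.X 0) (j : ℕ) : (T.π j).base '' T.nearLocus N x (j + 1) ⊆ T.nearLocus N x j := by
  rintro _ ⟨ξ, hξ, rfl⟩
  exact ((mem_nearLocus_succ_iff T hkey hperm x j ξ).mp hξ).1

/-- **Near points at stage `j+1` that are near to their image are near to `x`** — the converse reading used to put the near
points of `π_{j+1}` over `C_j = N_j(x)` inside `N_{j+1}(x)`. [cite: CossartJannsenSaito2020, Def. 6.34 (ii)] -/
theorem mem_nearLocus_succ_of_near (hkey : KeySetting T N) (hperm : ∀ j, IdealSheafData.IsPermissible (T.centreIdeal j))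
    (x : T.X 0) (j : ℕ) {ξ : T.X (j + 1)} (hover : (T.π j).base ξ ∈ T.nearLocus N x j)
    (hnear : Scheme.hsFun (T.X (j + 1)) N ξ = Scheme.hsFun (T.X j) N ((T.π j).base ξ)) : ξ ∈ T.nearLocus N x (j + 1) :=
  (mem_nearLocus_succ_iff T hkey hperm x j ξ).mpr ⟨hover, hnear⟩

end BlowupTowerNear

end Summit.ResolutionOfSingularities.ResolutionOfSingularities.Theorems.SigmaMaxModificationsCorridor3.Helpers

end
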